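import Summits.KontsevichZagierPeriods.KontsevichZagierPeriods.Theses.FurushoPentagon
import Literature.NumberTheory.Transcendental.KZLogCalculusProofs
import Literature.NumberTheory.Transcendental.SemialgebraicMapsProofs

/-!
# `HoffmanRelationInKZ`, line `dilation-homotopy-transposition`: the dilation calculus of `f_s`

Stub `stub_dilationCalculus` of the crux `HoffmanRelationInKZ` (stmt-KontsevichZagierPeriods-3930, route
FurushoPentagon).  For a non-empty admissible `s` (weight `n`, depth `k`) the cubical integrand
`f_s(x) = ∏_{l<k} T_{p_l}(x)/(1 − T_{p_{l+1}}(x))` (`T_m = x₀⋯x_{m−1}`, `p_l = s₁+⋯+s_l`, `p₀ = 0`, `p_l ≥ 2`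
for `l ≥ 1`) and its dilation kernel `K_s = f_s · ∑_l 1/(1 − T_{p_{l+1}})` satisfy, under the shear
`σ_c : x₀ ↦ c x₀` (`T_m ∘ σ_c = c T_m` for `m ≥ 1`): the closed form
`c f_s(σ_c x) = ∏_l (c T_{p_l}(x))/(1 − c T_{p_{l+1}}(x))`, a rational function of `c` without poles on
`[0,1]` for `x ∈ (0,1)ⁿ`, with derivative `K_s(σ_c x)` (Euler homogeneity); continuity on `[0,1]`;
`K_s ≥ 0`; and `ℚ`-semialgebraicity of `K_s(σ_λ x)/(1−u)` and `λ f_s(σ_λ x)/(1−u)` on the big band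
`{(u,x,λ) | (u,x) ∈ (0,1)ⁿ⁺¹, 0 ≤ λ ≤ 1}` (quotients of `ℚ`-polynomials, non-vanishing denominators).
All clauses are proved for abstract data (`T`, `σ`, `f`, `K` with defining hypotheses, block ends
`p : ℕ → ℕ`) and then specialised to `p l = (s.take l).sum`.

References: M. Kontsevich, D. Zagier, *Periods* (2001), §1.2; J. Bochnak, M. Coste, M.-F. Roy,
*Real Algebraic Geometry* (1998), §2.2.
-/

noncomputable section

open Set MeasureTheory
open Literature.NumberTheory.Transcendental Literature.ModelTheory.ExponentialFields

namespace Summit.KontsevichZagierPeriods.FurushoPentagon.HoffmanRelationInKZ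

/-! ## Partial products `T_m(x) = x₀ ⋯ x_{m-1}` under the shear `x₀ ↦ c x₀` -/

section PartialProducts

variable {n : ℕ}

/-- The empty partial product is `T₀ = 1`. [folklore] -/
theorem pprod_zero (T : ℕ → (Fin (n + 1) → ℝ) → ℝ) (hT : ∀ m x, T m x = ∏ j : Fin (n + 1), if (j : ℕ) < m then x j else 1)
    (x : Fin (n + 1) → ℝ) : T 0 x = 1 := by
  rw [hT]
  simp

/-- Under the shear `x₀ ↦ c x₀` a non-empty partial product `T_m = x₀ ⋯ x_{m-1}` (`m ≥ 1`) is
multiplied by `c` (it contains the factor `x₀` exactly once). [folklore] -/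
theorem pprod_shear (T : ℕ → (Fin (n + 1) → ℝ) → ℝ) (hT : ∀ m x, T m x = ∏ j : Fin (n + 1), if (j : ℕ) < m then x j else 1)
    (σ : ℝ → (Fin (n + 1) → ℝ) → (Fin (n + 1) → ℝ)) (hσ : ∀ c x j, σ c x j = if (j : ℕ) = 0 then c * x j else x j)
    {m : ℕ} (hm : 1 ≤ m) (c : ℝ) (x : Fin (n + 1) → ℝ) : T m (σ c x) = c * T m x := by
  rw [hT, hT, Fin.prod_univ_succ, Fin.prod_univ_succ]
  have h0 : ((0 : Fin (n + 1)) : ℕ) < m := by simp; omega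
  have hz : σ c x 0 = c * x 0 := by rw [hσ]; simp
  have hrest : ∀ j : Fin n, σ c x j.succ = x j.succ := fun j => by rw [hσ]; simp
  simp only [if_pos h0, hz, hrest]
  ring

/-- Partial products of non-negative numbers are non-negative. [folklore] -/
theorem pprod_nonneg (T : ℕ → (Fin (n + 1) → ℝ) → ℝ) (hT : ∀ m x, T m x = ∏ j : Fin (n + 1), if (j : ℕ) < m then x j else 1)
    {x : Fin (n + 1) → ℝ} (hx : ∀ i, 0 ≤ x i) (m : ℕ) : 0 ≤ T m x := by
  rw [hT]
  exact Finset.prod_nonneg fun j _ => by split_ifs <;> [exact hx j; exact zero_le_one]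

/-- A non-empty partial product of numbers in `(0,1)` is `< 1`. [folklore] -/
theorem pprod_lt_one (T : ℕ → (Fin (n + 1) → ℝ) → ℝ) (hT : ∀ m x, T m x = ∏ j : Fin (n + 1), if (j : ℕ) < m then x j else 1)
    {x : Fin (n + 1) → ℝ} (hx : ∀ i, x i ∈ Ioo (0:ℝ) 1) {m : ℕ} (hm : 1 ≤ m) : T m x < 1 := by
  rw [hT, Fin.prod_univ_succ]
  have h0 : ((0 : Fin (n + 1)) : ℕ) < m := by simp; omega
  rw [if_pos h0]
  refine mul_lt_one_of_nonneg_of_lt_one_left (hx 0).1.le (hx 0).2 ?_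
  exact Finset.prod_le_one (fun j _ => by split_ifs <;> [exact (hx _).1.le; exact zero_le_one])
    (fun j _ => by split_ifs <;> [exact (hx _).2.le; exact le_rfl])

/-- The denominators `1 − c·T_m(x)` (`m ≥ 1`, `x ∈ (0,1)ⁿ`, `0 ≤ c ≤ 1`) are positive. [folklore] -/
theorem one_sub_mul_pprod_pos (T : ℕ → (Fin (n + 1) → ℝ) → ℝ) (hT : ∀ m x, T m x = ∏ j : Fin (n + 1), if (j : ℕ) < m then x j else 1)
    {x : Fin (n + 1) → ℝ} (hx : ∀ i, x i ∈ Ioo (0:ℝ) 1) {c : ℝ} (hc0 : 0 ≤ c) (hc1 : c ≤ 1)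
    {m : ℕ} (hm : 1 ≤ m) : 0 < 1 - c * T m x := by
  have h1 := pprod_lt_one T hT hx hm
  have h0 : 0 ≤ T m x := pprod_nonneg T hT (fun i => (hx i).1.le) m
  have h2 : c * T m x ≤ T m x := mul_le_of_le_one_left h0 hc1
  have h3 : 0 ≤ c * T m x := mul_nonneg hc0 h0
  linarith

/-- The shear with `c ≥ 0` preserves non-negativity of the coordinates. [folklore] -/
theorem shear_nonneg (σ : ℝ → (Fin (n + 1) → ℝ) → (Fin (n + 1) → ℝ)) (hσ : ∀ c x j, σ c x j = if (j : ℕ) = 0 then c * x j else x j) {c : ℝ} (hc : 0 ≤ c)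
    {x : Fin (n + 1) → ℝ} (hx : ∀ i, 0 ≤ x i) (j : Fin (n + 1)) : 0 ≤ σ c x j := by
  rw [hσ]
  split_ifs <;> [exact mul_nonneg hc (hx j); exact hx j]

/-- `c ↦ T_m(σ_c x)` is continuous (a finite product of affine functions of `c`). [folklore] -/
theorem continuous_pprod_shear (T : ℕ → (Fin (n + 1) → ℝ) → ℝ) (hT : ∀ m x, T m x = ∏ j : Fin (n + 1), if (j : ℕ) < m then x j else 1)
    (σ : ℝ → (Fin (n + 1) → ℝ) → (Fin (n + 1) → ℝ)) (hσ : ∀ c x j, σ c x j = if (j : ℕ) = 0 then c * x j else x j) (m : ℕ) (x : Fin (n + 1) → ℝ) :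
    Continuous fun c : ℝ => T m (σ c x) := by
  simp only [hT]
  refine continuous_finsetProd _ fun j _ => ?_
  simp only [hσ]
  split_ifs <;> fun_prop

/-- The sheared partial products `T_m(σ_λ x)`, read in the coordinates `z = (u, x, λ) ∈ ℝⁿ⁺²`
(`x = tail (init z)`, `λ = z last`), are `ℚ`-polynomials in `z`. [folklore] -/
theorem exists_mvPolynomial_pprod_shear (T : ℕ → (Fin (n + 1) → ℝ) → ℝ) (hT : ∀ m x, T m x = ∏ j : Fin (n + 1), if (j : ℕ) < m then x j else 1)
    (σ : ℝ → (Fin (n + 1) → ℝ) → (Fin (n + 1) → ℝ)) (hσ : ∀ c x j, σ c x j = if (j : ℕ) = 0 then c * x j else x j) :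
    ∃ P : ℕ → MvPolynomial (Fin (n + 1 + 2)) ℚ, ∀ (m : ℕ) (z : Fin (n + 1 + 2) → ℝ),
      MvPolynomial.aeval z (P m) =
        T m (σ (z (Fin.last (n + 1 + 1))) (Fin.tail (Fin.init z))) := by
  refine ⟨fun m => ∏ j : Fin (n + 1), if (j : ℕ) < m then
      (if (j : ℕ) = 0 then MvPolynomial.X (Fin.last (n + 1 + 1)) * MvPolynomial.X (Fin.castSucc j.succ)
        else MvPolynomial.X (Fin.castSucc j.succ)) else 1, fun m z => ?_⟩
  dsimp only
  rw [hT, map_prod]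
  refine Finset.prod_congr rfl fun j _ => ?_
  rw [hσ]
  split_ifs <;> simp [Fin.tail, Fin.init]

/-- The big band `{(u, x, λ) | (u, x) ∈ (0,1)ⁿ⁺¹, 0 ≤ λ ≤ 1} ⊆ ℝⁿ⁺²` is `ℚ`-semialgebraic.
[cite: KontsevichZagier2001, §1.1] -/
theorem isSemialgebraic_bigBand (N : ℕ) :
    IsSemialgebraic ℚ {z : Fin (N + 2) → ℝ | (∀ i, Fin.init z i ∈ Set.Ioo (0:ℝ) 1) ∧
      0 ≤ z (Fin.last (N + 1)) ∧ z (Fin.last (N + 1)) ≤ 1} := by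
  have h : {z : Fin (N + 2) → ℝ | (∀ i, Fin.init z i ∈ Set.Ioo (0:ℝ) 1) ∧
      0 ≤ z (Fin.last (N + 1)) ∧ z (Fin.last (N + 1)) ≤ 1} =
      (⋂ i ∈ (Finset.univ : Finset (Fin (N + 1))),
        ({z | 0 < MvPolynomial.aeval z (MvPolynomial.X (Fin.castSucc i) : MvPolynomial (Fin (N + 2)) ℚ)} ∩
          {z | 0 < MvPolynomial.aeval z
            (1 - MvPolynomial.X (Fin.castSucc i) : MvPolynomial (Fin (N + 2)) ℚ)})) ∩
      ({z | 0 ≤ MvPolynomial.aeval z (MvPolynomial.X (Fin.last (N + 1)) : MvPolynomial (Fin (N + 2)) ℚ)} ∩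
        {z | 0 ≤ MvPolynomial.aeval z
          (1 - MvPolynomial.X (Fin.last (N + 1)) : MvPolynomial (Fin (N + 2)) ℚ)}) := by
    ext z
    simp [Fin.init, sub_pos, sub_nonneg, forall_and]
  rw [h]
  exact (IsSemialgebraic.biInter _ _ fun i _ =>
    (isSemialgebraic_setOf_eval_pos _).inter (isSemialgebraic_setOf_eval_pos _)).inter
    ((isSemialgebraic_setOf_eval_nonneg _).inter (isSemialgebraic_setOf_eval_nonneg _))

end PartialProducts

/-! ## The cubical integrand under the shear: closed form, derivative, continuity, sign -/

section Clauses

variable {n k : ℕ}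

/-- Closed form: `c · f(σ_c x) = ∏_{l<k} (c·T_{p_l}(x)) / (1 − c·T_{p_{l+1}}(x))` for every real `c`
(the factor `l = 0` has `T_{p_0} = T_0 = 1` and absorbs the extra `c`; every other `T_{p_l}`, `p_l ≥ 1`,
is multiplied by `c` under the shear). [folklore] -/
theorem shear_mul_closedForm (T : ℕ → (Fin (n + 1) → ℝ) → ℝ) (hT : ∀ m x, T m x = ∏ j : Fin (n + 1), if (j : ℕ) < m then x j else 1)
    (σ : ℝ → (Fin (n + 1) → ℝ) → (Fin (n + 1) → ℝ)) (hσ : ∀ c x j, σ c x j = if (j : ℕ) = 0 then c * x j else x j)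
    (p : ℕ → ℕ) (hp0 : p 0 = 0) (hp : ∀ l, 1 ≤ l → 1 ≤ p l) (f : (Fin (n + 1) → ℝ) → ℝ)
    (hf : ∀ x, f x = ∏ l : Fin (k + 1), T (p l) x / (1 - T (p (l + 1)) x)) (c : ℝ)
    (x : Fin (n + 1) → ℝ) :
    c * f (σ c x) = ∏ l : Fin (k + 1), c * T (p l) x / (1 - c * T (p (l + 1)) x) := by
  have hT0 : ∀ y, T (p 0) y = 1 := fun y => by rw [hp0]; exact pprod_zero T hT y
  have hTs : ∀ (l : ℕ) (y : Fin (n + 1) → ℝ), T (p (l + 1)) (σ c y) = c * T (p (l + 1)) y :=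
    fun l y => pprod_shear T hT σ hσ (hp (l + 1) (Nat.le_add_left 1 l)) c y
  rw [hf, Fin.prod_univ_succ, Fin.prod_univ_succ]
  simp only [Fin.val_zero, Fin.val_succ, hT0, hTs]
  ring

/-- Clause (1), Euler homogeneity: for `x ∈ (0,1)ⁿ` and `c ∈ (0,1)`,
`d/dc [c · f(σ_c x)] = K(σ_c x)` with `K = f · ∑_l 1/(1 − T_{p_{l+1}})` (product rule on the closed form;
each factor `c a/(1 − c b)` has derivative `a/(1 − c b)²`, and `∑_l g·a_l/((1−c b_l)² u_l) = (g/c) ∑_l 1/(1−c b_l)`).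
[folklore] -/
theorem shear_mul_hasDerivAt (T : ℕ → (Fin (n + 1) → ℝ) → ℝ) (hT : ∀ m x, T m x = ∏ j : Fin (n + 1), if (j : ℕ) < m then x j else 1)
    (σ : ℝ → (Fin (n + 1) → ℝ) → (Fin (n + 1) → ℝ)) (hσ : ∀ c x j, σ c x j = if (j : ℕ) = 0 then c * x j else x j)
    (p : ℕ → ℕ) (hp0 : p 0 = 0) (hp : ∀ l, 1 ≤ l → 1 ≤ p l) (f K : (Fin (n + 1) → ℝ) → ℝ)
    (hf : ∀ x, f x = ∏ l : Fin (k + 1), T (p l) x / (1 - T (p (l + 1)) x))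
    (hK : ∀ x, K x = f x * ∑ l : Fin (k + 1), 1 / (1 - T (p (l + 1)) x))
    {x : Fin (n + 1) → ℝ} (hx : ∀ i, x i ∈ Ioo (0:ℝ) 1) {c : ℝ} (hc : c ∈ Ioo (0:ℝ) 1) :
    HasDerivAt (fun l : ℝ => l * f (σ l x)) (K (σ c x)) c := by
  have hstar := shear_mul_closedForm T hT σ hσ p hp0 hp f hf
  have hD : ∀ l : Fin (k + 1), 0 < 1 - c * T (p (l + 1)) x := fun l =>
    one_sub_mul_pprod_pos T hT hx hc.1.le hc.2.le (hp _ (Nat.le_add_left 1 l))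
  have hu : ∀ i ∈ (Finset.univ : Finset (Fin (k + 1))),
      HasDerivAt (fun y : ℝ => y * T (p i) x / (1 - y * T (p (i + 1)) x))
        ((T (p i) x * (1 - c * T (p (i + 1)) x) - c * T (p i) x * -T (p (i + 1)) x) /
          (1 - c * T (p (i + 1)) x) ^ 2) c :=
    fun i _ => (hasDerivAt_mul_const _).div ((hasDerivAt_mul_const _).const_sub 1) (hD i).ne'
  have hg := HasDerivAt.fun_finsetProd hu
  have hfun : (fun l : ℝ => l * f (σ l x)) =
      fun y => ∏ i : Fin (k + 1), y * T (p i) x / (1 - y * T (p (i + 1)) x) :=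
    funext fun l => hstar l x
  rw [hfun]
  refine hg.congr_deriv ?_
  have hTs : ∀ l : ℕ, T (p (l + 1)) (σ c x) = c * T (p (l + 1)) x :=
    fun l => pprod_shear T hT σ hσ (hp (l + 1) (Nat.le_add_left 1 l)) c x
  have hfval : f (σ c x) = (∏ i : Fin (k + 1), c * T (p i) x / (1 - c * T (p (i + 1)) x)) / c :=
    eq_div_of_mul_eq hc.1.ne' (by rw [mul_comm]; exact hstar c x)
  rw [hK, hfval]
  simp only [hTs, smul_eq_mul]
  rw [Finset.mul_sum]
  refine Finset.sum_congr rfl fun i _ => ?_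
  have hsplit := Finset.mul_prod_erase Finset.univ
    (fun j : Fin (k + 1) => c * T (p j) x / (1 - c * T (p (j + 1)) x)) (Finset.mem_univ i)
  rw [← hsplit]
  have hc0 : c ≠ 0 := hc.1.ne'
  have hDi : 1 - c * T (p (i + 1)) x ≠ 0 := (hD i).ne'
  field_simp
  ring

/-- Clause (2) up to the factor `c`: continuity of `c ↦ f(σ_c x)` on `[0,1]` for `x ∈ (0,1)ⁿ` (a finite
product of quotients of continuous functions, denominators `1 − c T_{p_{l+1}}(x) ≥ 1 − x₀ > 0`). [folklore] -/
theorem shear_continuousOn (T : ℕ → (Fin (n + 1) → ℝ) → ℝ) (hT : ∀ m x, T m x = ∏ j : Fin (n + 1), if (j : ℕ) < m then x j else 1)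
    (σ : ℝ → (Fin (n + 1) → ℝ) → (Fin (n + 1) → ℝ)) (hσ : ∀ c x j, σ c x j = if (j : ℕ) = 0 then c * x j else x j)
    (p : ℕ → ℕ) (hp : ∀ l, 1 ≤ l → 1 ≤ p l) (f : (Fin (n + 1) → ℝ) → ℝ)
    (hf : ∀ x, f x = ∏ l : Fin (k + 1), T (p l) x / (1 - T (p (l + 1)) x))
    {x : Fin (n + 1) → ℝ} (hx : ∀ i, x i ∈ Ioo (0:ℝ) 1) :
    ContinuousOn (fun l : ℝ => f (σ l x)) (Icc 0 1) := by
  have hTs : ∀ (c : ℝ) (l : ℕ), T (p (l + 1)) (σ c x) = c * T (p (l + 1)) x :=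
    fun c l => pprod_shear T hT σ hσ (hp (l + 1) (Nat.le_add_left 1 l)) c x
  simp only [hf, hTs]
  refine continuousOn_finsetProd _ fun l _ => ?_
  exact (continuous_pprod_shear T hT σ hσ (p l) x).continuousOn.div
    (Continuous.continuousOn (by fun_prop))
    fun c hc => (one_sub_mul_pprod_pos T hT hx hc.1 hc.2 (hp _ (Nat.le_add_left 1 l))).ne'

/-- Clause (3): continuity of the kernel `c ↦ K(σ_c x) = f(σ_c x) · ∑_l 1/(1 − c T_{p_{l+1}}(x))` on
`[0,1]`. [folklore] -/
theorem kernel_shear_continuousOn (T : ℕ → (Fin (n + 1) → ℝ) → ℝ) (hT : ∀ m x, T m x = ∏ j : Fin (n + 1), if (j : ℕ) < m then x j else 1)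
    (σ : ℝ → (Fin (n + 1) → ℝ) → (Fin (n + 1) → ℝ)) (hσ : ∀ c x j, σ c x j = if (j : ℕ) = 0 then c * x j else x j)
    (p : ℕ → ℕ) (hp : ∀ l, 1 ≤ l → 1 ≤ p l) (f K : (Fin (n + 1) → ℝ) → ℝ)
    (hf : ∀ x, f x = ∏ l : Fin (k + 1), T (p l) x / (1 - T (p (l + 1)) x))
    (hK : ∀ x, K x = f x * ∑ l : Fin (k + 1), 1 / (1 - T (p (l + 1)) x))
    {x : Fin (n + 1) → ℝ} (hx : ∀ i, x i ∈ Ioo (0:ℝ) 1) :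
    ContinuousOn (fun l : ℝ => K (σ l x)) (Icc 0 1) := by
  have hTs : ∀ (c : ℝ) (l : ℕ), T (p (l + 1)) (σ c x) = c * T (p (l + 1)) x :=
    fun c l => pprod_shear T hT σ hσ (hp (l + 1) (Nat.le_add_left 1 l)) c x
  simp only [hK, hTs]
  refine (shear_continuousOn T hT σ hσ p hp f hf hx).mul (continuousOn_finsetSum _ fun l _ => ?_)
  exact continuousOn_const.div (Continuous.continuousOn (by fun_prop))
    fun c hc => (one_sub_mul_pprod_pos T hT hx hc.1 hc.2 (hp _ (Nat.le_add_left 1 l))).ne'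

/-- Clause (4): the kernel is non-negative, `K(σ_c x) ≥ 0` for `x ∈ (0,1)ⁿ`, `c ∈ [0,1]` (products and
quotients of non-negative numbers with positive denominators). [folklore] -/
theorem kernel_shear_nonneg (T : ℕ → (Fin (n + 1) → ℝ) → ℝ) (hT : ∀ m x, T m x = ∏ j : Fin (n + 1), if (j : ℕ) < m then x j else 1)
    (σ : ℝ → (Fin (n + 1) → ℝ) → (Fin (n + 1) → ℝ)) (hσ : ∀ c x j, σ c x j = if (j : ℕ) = 0 then c * x j else x j)
    (p : ℕ → ℕ) (hp : ∀ l, 1 ≤ l → 1 ≤ p l) (f K : (Fin (n + 1) → ℝ) → ℝ)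
    (hf : ∀ x, f x = ∏ l : Fin (k + 1), T (p l) x / (1 - T (p (l + 1)) x))
    (hK : ∀ x, K x = f x * ∑ l : Fin (k + 1), 1 / (1 - T (p (l + 1)) x))
    {x : Fin (n + 1) → ℝ} (hx : ∀ i, x i ∈ Ioo (0:ℝ) 1) {c : ℝ} (hc : c ∈ Icc (0:ℝ) 1) :
    0 ≤ K (σ c x) := by
  have hTs : ∀ l : ℕ, T (p (l + 1)) (σ c x) = c * T (p (l + 1)) x :=
    fun l => pprod_shear T hT σ hσ (hp (l + 1) (Nat.le_add_left 1 l)) c x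
  rw [hK, hf]
  refine mul_nonneg (Finset.prod_nonneg fun l _ => div_nonneg ?_ ?_)
    (Finset.sum_nonneg fun l _ => ?_)
  · exact pprod_nonneg T hT (shear_nonneg σ hσ hc.1 fun i => (hx i).1.le) _
  · rw [hTs]
    exact (one_sub_mul_pprod_pos T hT hx hc.1 hc.2 (hp _ (Nat.le_add_left 1 l))).le
  · rw [hTs]
    exact div_nonneg zero_le_one
      (one_sub_mul_pprod_pos T hT hx hc.1 hc.2 (hp _ (Nat.le_add_left 1 l))).le

/-! ## Semialgebraicity on the big band -/

/-- On the big band the denominators of the peak integrand are positive: `1 − T_{p_{l+1}}(σ_λ x) > 0`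
and `1 − u > 0`. [folklore] -/
theorem bigBand_denominators_pos (T : ℕ → (Fin (n + 1) → ℝ) → ℝ) (hT : ∀ m x, T m x = ∏ j : Fin (n + 1), if (j : ℕ) < m then x j else 1)
    (σ : ℝ → (Fin (n + 1) → ℝ) → (Fin (n + 1) → ℝ)) (hσ : ∀ c x j, σ c x j = if (j : ℕ) = 0 then c * x j else x j)
    (p : ℕ → ℕ) (hp : ∀ l, 1 ≤ l → 1 ≤ p l) {z : Fin (n + 1 + 2) → ℝ}
    (hz : z ∈ {z : Fin (n + 1 + 2) → ℝ | (∀ i, Fin.init z i ∈ Set.Ioo (0:ℝ) 1) ∧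
      0 ≤ z (Fin.last (n + 1 + 1)) ∧ z (Fin.last (n + 1 + 1)) ≤ 1}) :
    (∀ l : ℕ, 0 < 1 - T (p (l + 1)) (σ (z (Fin.last (n + 1 + 1))) (Fin.tail (Fin.init z)))) ∧
      0 < 1 - z 0 := by
  have hx : ∀ i, Fin.tail (Fin.init z) i ∈ Ioo (0:ℝ) 1 := fun i => hz.1 i.succ
  refine ⟨fun l => ?_, ?_⟩
  · rw [pprod_shear T hT σ hσ (hp (l + 1) (Nat.le_add_left 1 l))]
    exact one_sub_mul_pprod_pos T hT hx hz.2.1 hz.2.2 (hp (l + 1) (Nat.le_add_left 1 l))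
  · have h0 := (hz.1 0).2
    simp only [Fin.init, Fin.castSucc_zero] at h0
    linarith

/-- Clauses (5)–(6): the peak integrand `K(σ_λ x)/(1 − u)` and the primitive `λ f(σ_λ x)/(1 − u)` are
`ℚ`-semialgebraic functions on the big band (a finite sum of quotients, resp. a quotient, of `ℚ`-polynomials
with non-vanishing denominators). [cite: BochnakCosteRoy1998, Prop. 2.2.6] -/
theorem bigBand_isSemialgebraicFunOn (T : ℕ → (Fin (n + 1) → ℝ) → ℝ) (hT : ∀ m x, T m x = ∏ j : Fin (n + 1), if (j : ℕ) < m then x j else 1)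
    (σ : ℝ → (Fin (n + 1) → ℝ) → (Fin (n + 1) → ℝ)) (hσ : ∀ c x j, σ c x j = if (j : ℕ) = 0 then c * x j else x j)
    (p : ℕ → ℕ) (hp : ∀ l, 1 ≤ l → 1 ≤ p l) (f K : (Fin (n + 1) → ℝ) → ℝ)
    (hf : ∀ x, f x = ∏ l : Fin (k + 1), T (p l) x / (1 - T (p (l + 1)) x))
    (hK : ∀ x, K x = f x * ∑ l : Fin (k + 1), 1 / (1 - T (p (l + 1)) x)) :
    IsSemialgebraicFunOn ℚ {z : Fin (n + 1 + 2) → ℝ | (∀ i, Fin.init z i ∈ Set.Ioo (0:ℝ) 1) ∧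
      0 ≤ z (Fin.last (n + 1 + 1)) ∧ z (Fin.last (n + 1 + 1)) ≤ 1}
      (fun z => K (σ (z (Fin.last (n + 1 + 1))) (Fin.tail (Fin.init z))) / (1 - z 0)) ∧
    IsSemialgebraicFunOn ℚ {z : Fin (n + 1 + 2) → ℝ | (∀ i, Fin.init z i ∈ Set.Ioo (0:ℝ) 1) ∧
      0 ≤ z (Fin.last (n + 1 + 1)) ∧ z (Fin.last (n + 1 + 1)) ≤ 1}
      (fun z => z (Fin.last (n + 1 + 1)) * f (σ (z (Fin.last (n + 1 + 1))) (Fin.tail (Fin.init z))) /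
        (1 - z 0)) := by
  obtain ⟨P, hP⟩ := exists_mvPolynomial_pprod_shear T hT σ hσ
  have hB := isSemialgebraic_bigBand (n + 1)
  obtain ⟨A, hA⟩ : ∃ A : MvPolynomial (Fin (n + 1 + 2)) ℚ, ∀ z : Fin (n + 1 + 2) → ℝ,
      MvPolynomial.aeval z A =
        ∏ l : Fin (k + 1), T (p l) (σ (z (Fin.last (n + 1 + 1))) (Fin.tail (Fin.init z))) :=
    ⟨∏ l : Fin (k + 1), P (p l), fun z => by
      rw [map_prod]; exact Finset.prod_congr rfl fun l _ => hP _ z⟩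
  obtain ⟨B, hBev⟩ : ∃ B : MvPolynomial (Fin (n + 1 + 2)) ℚ, ∀ z : Fin (n + 1 + 2) → ℝ,
      MvPolynomial.aeval z B =
        ∏ l : Fin (k + 1), (1 - T (p (l + 1)) (σ (z (Fin.last (n + 1 + 1))) (Fin.tail (Fin.init z)))) :=
    ⟨∏ l : Fin (k + 1), (1 - P (p (l + 1))), fun z => by
      rw [map_prod]; exact Finset.prod_congr rfl fun l _ => by rw [map_sub, map_one, hP]⟩
  have key : ∀ z : Fin (n + 1 + 2) → ℝ, f (σ (z (Fin.last (n + 1 + 1))) (Fin.tail (Fin.init z))) =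
      MvPolynomial.aeval z A / MvPolynomial.aeval z B := fun z => by
    rw [hf, hA, hBev, Finset.prod_div_distrib]
  refine ⟨(KZ.isSemialgebraicFunOn_finset_sum (Finset.univ : Finset (Fin (k + 1))) hB
    (f := fun l z => MvPolynomial.aeval z A /
      MvPolynomial.aeval z (B * (1 - P (p (l + 1))) * (1 - MvPolynomial.X 0)))
    fun l _ => isSemialgebraicFunOn_aeval_div_aeval hB _ _ fun z hz => ?_).congr fun z hz => ?_,
    (isSemialgebraicFunOn_aeval_div_aeval hB (MvPolynomial.X (Fin.last (n + 1 + 1)) * A)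
      (B * (1 - MvPolynomial.X 0)) fun z hz => ?_).congr fun z _ => ?_⟩
  · obtain ⟨h1, h2⟩ := bigBand_denominators_pos T hT σ hσ p hp hz
    simp only [map_mul, map_sub, map_one, hP, MvPolynomial.aeval_X, hBev]
    exact mul_ne_zero (mul_ne_zero (Finset.prod_ne_zero_iff.mpr fun l _ => (h1 l).ne') (h1 l).ne')
      h2.ne'
  · show (∑ l : Fin (k + 1), MvPolynomial.aeval z A /
        MvPolynomial.aeval z (B * (1 - P (p (l + 1))) * (1 - MvPolynomial.X 0))) = _
    rw [hK, key z, Finset.mul_sum, Finset.sum_div]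
    refine Finset.sum_congr rfl fun l _ => ?_
    simp only [map_mul, map_sub, map_one, hP, MvPolynomial.aeval_X]
    rw [mul_one_div, div_div, div_div, mul_assoc]
  · obtain ⟨h1, h2⟩ := bigBand_denominators_pos T hT σ hσ p hp hz
    simp only [map_mul, map_sub, map_one, MvPolynomial.aeval_X, hBev]
    exact mul_ne_zero (Finset.prod_ne_zero_iff.mpr fun l _ => (h1 l).ne') h2.ne'
  · show MvPolynomial.aeval z (MvPolynomial.X (Fin.last (n + 1 + 1)) * A) /
        MvPolynomial.aeval z (B * (1 - MvPolynomial.X 0)) = _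
    rw [key z]
    simp only [map_mul, map_sub, map_one, MvPolynomial.aeval_X]
    rw [mul_div_assoc', div_div]

end Clauses

/-! ## Assembly -/

/-- The dilation calculus for abstract data: dimension `N ≥ 1`, depth `k ≥ 1`, partial products `T`,
shear `σ`, block ends `p` with `p 0 = 0` and `p l ≥ 1` (`l ≥ 1`), integrand `f` and kernel `K` given by
their defining formulas — the six clauses. [folklore] -/
theorem dilationCalculus_of {N k : ℕ} (hN : 0 < N) (hk : 0 < k) (T : ℕ → (Fin N → ℝ) → ℝ)
    (hT : ∀ m x, T m x = ∏ j : Fin N, if (j : ℕ) < m then x j else 1)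
    (σ : ℝ → (Fin N → ℝ) → (Fin N → ℝ)) (hσ : ∀ c x j, σ c x j = if (j : ℕ) = 0 then c * x j else x j)
    (p : ℕ → ℕ) (hp0 : p 0 = 0) (hp : ∀ l, 1 ≤ l → 1 ≤ p l) (f K : (Fin N → ℝ) → ℝ)
    (hf : ∀ x, f x = ∏ l : Fin k, T (p l) x / (1 - T (p (l + 1)) x))
    (hK : ∀ x, K x = f x * ∑ l : Fin k, 1 / (1 - T (p (l + 1)) x)) :
    (∀ x : Fin N → ℝ, (∀ i, x i ∈ Set.Ioo (0:ℝ) 1) → ∀ l ∈ Set.Ioo (0:ℝ) 1,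
      HasDerivAt (fun l : ℝ => l * f (σ l x)) (K (σ l x)) l) ∧
    (∀ x : Fin N → ℝ, (∀ i, x i ∈ Set.Ioo (0:ℝ) 1) →
      ContinuousOn (fun l : ℝ => l * f (σ l x)) (Set.Icc 0 1)) ∧
    (∀ x : Fin N → ℝ, (∀ i, x i ∈ Set.Ioo (0:ℝ) 1) →
      ContinuousOn (fun l : ℝ => K (σ l x)) (Set.Icc 0 1)) ∧
    (∀ x : Fin N → ℝ, (∀ i, x i ∈ Set.Ioo (0:ℝ) 1) → ∀ l ∈ Set.Icc (0:ℝ) 1, 0 ≤ K (σ l x)) ∧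
    IsSemialgebraicFunOn ℚ {z : Fin (N + 2) → ℝ | (∀ i, Fin.init z i ∈ Set.Ioo (0:ℝ) 1) ∧
      0 ≤ z (Fin.last (N + 1)) ∧ z (Fin.last (N + 1)) ≤ 1}
      (fun z => K (σ (z (Fin.last (N + 1))) (Fin.tail (Fin.init z))) / (1 - z 0)) ∧
    IsSemialgebraicFunOn ℚ {z : Fin (N + 2) → ℝ | (∀ i, Fin.init z i ∈ Set.Ioo (0:ℝ) 1) ∧
      0 ≤ z (Fin.last (N + 1)) ∧ z (Fin.last (N + 1)) ≤ 1}
      (fun z => z (Fin.last (N + 1)) * f (σ (z (Fin.last (N + 1))) (Fin.tail (Fin.init z))) /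
        (1 - z 0)) := by
  obtain ⟨n, rfl⟩ : ∃ n, N = n + 1 := ⟨N - 1, by omega⟩
  obtain ⟨k, rfl⟩ : ∃ k', k = k' + 1 := ⟨k - 1, by omega⟩
  exact ⟨fun x hx c hc => shear_mul_hasDerivAt T hT σ hσ p hp0 hp f K hf hK hx hc,
    fun x hx => continuousOn_id.mul (shear_continuousOn T hT σ hσ p hp f hf hx),
    fun x hx => kernel_shear_continuousOn T hT σ hσ p hp f K hf hK hx,
    fun x hx c hc => kernel_shear_nonneg T hT σ hσ p hp f K hf hK hx hc,
    bigBand_isSemialgebraicFunOn T hT σ hσ p hp f K hf hK⟩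

/-- Block ends of a non-empty admissible index are `≥ 1` from the first block on:
`(s.take l).sum ≥ s.head ≥ 2` for `l ≥ 1`. [folklore] -/
theorem one_le_sum_take {s : List ℕ} (hs : MZV.IsAdmissible s) (hne : s ≠ []) {l : ℕ} (hl : 1 ≤ l) :
    1 ≤ (s.take l).sum := by
  obtain ⟨a, t, rfl⟩ := List.exists_cons_of_ne_nil hne
  obtain ⟨l, rfl⟩ : ∃ l', l = l' + 1 := ⟨l - 1, by omega⟩
  rw [List.take_succ_cons, List.sum_cons]
  have h2 : 2 ≤ a := hs.2 (List.cons_ne_nil a t)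
  omega

/-- STUB `stub_dilationCalculus` (dilation calculus of `f_s`).  For a non-empty admissible `s`: Euler
homogeneity `∂_λ[λ·f_s(λx₀, x')] = K_s(λx₀, x')` with `K_s = f_s · ∑_l 1/(1 − T_{p_{l+1}})` (`λ ∈ (0,1)`,
`x` in the open cube), continuity of `λ ↦ λ f_s(λx₀,x')` and of `λ ↦ K_s(λx₀,x')` on `[0,1]`, `K_s ≥ 0`,
and `ℚ`-semialgebraicity of the peak integrand `K_s(λx₀,x')/(1−u)` and of its primitive
`λ f_s(λx₀,x')/(1−u)` on the big band `{(u,x) ∈ (0,1)ⁿ⁺¹, 0 ≤ λ ≤ 1}` — the specialisation of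
`dilationCalculus_of` to `T_m(x) = ∏_{j<m} x_j` and `p_l = (s.take l).sum`. [folklore] -/
theorem stub_dilationCalculus : ∀ (s : List ℕ), MZV.IsAdmissible s → s ≠ [] → ∀ (f : (Fin (MZV.weight s) → ℝ) → ℝ) (K : (Fin (MZV.weight s) → ℝ) → ℝ) (σ : ℝ → (Fin (MZV.weight s) → ℝ) → (Fin (MZV.weight s) → ℝ)), (∀ x, f x = ∏ l : Fin s.length, (∏ j : Fin (MZV.weight s), if (j : ℕ) < (s.take l).sum then x j else 1) / (1 - (∏ j : Fin (MZV.weight s), if (j : ℕ) < (s.take ((l : ℕ) + 1)).sum then x j else 1))) → (∀ x, K x = f x * ∑ l : Fin s.length, 1 / (1 - (∏ j : Fin (MZV.weight s), if (j : ℕ) < (s.take ((l : ℕ) + 1)).sum then x j else 1))) → (∀ (c : ℝ) (x : Fin (MZV.weight s) → ℝ) (j : Fin (MZV.weight s)), σ c x j = if (j : ℕ) = 0 then c * x j else x j) → ((∀ x : Fin (MZV.weight s) → ℝ, (∀ i, x i ∈ Set.Ioo (0:ℝ) 1) → ∀ l ∈ Set.Ioo (0:ℝ) 1, HasDerivAt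 (fun l : ℝ => l * f (σ l x)) (K (σ l x)) l) ∧ (∀ x : Fin (MZV.weight s) → ℝ, (∀ i, x i ∈ Set.Ioo (0:ℝ) 1) → ContinuousOn (fun l : ℝ => l * f (σ l x)) (Set.Icc 0 1)) ∧ (∀ x : Fin (MZV.weight s) → ℝ, (∀ i, x i ∈ Set.Ioo (0:ℝ) 1) → ContinuousOn (fun l : ℝ => K (σ l x)) (Set.Icc 0 1)) ∧ (∀ x : Fin (MZV.weight s) → ℝ, (∀ i, x i ∈ Set.Ioo (0:ℝ) 1) → ∀ l ∈ Set.Icc (0:ℝ) 1, 0 ≤ K (σ l x)) ∧ IsSemialgebraicFunOn ℚ {z : Fin (MZV.weight s + 2) → ℝ | (∀ i, Fin.init z i ∈ Set.Ioo (0:ℝ) 1) ∧ 0 ≤ z (Fin.last (MZV.weight s + 1)) ∧ z (Fin.last (MZV.weight s + 1)) ≤ 1} (fun z => K (σ (z (Fin.last (MZV.weight s + 1))) (Fin.tail (Fin.init z))) / (1 - z 0)) ∧ IsSemialgebraicFunOn ℚ {z : Fin (MZV.weight s + 2) → ℝ | (∀ i, Fin.init z i ∈ Set.Ioo (0:ℝ)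 1) ∧ 0 ≤ z (Fin.last (MZV.weight s + 1)) ∧ z (Fin.last (MZV.weight s + 1)) ≤ 1} (fun z => z (Fin.last (MZV.weight s + 1)) * f (σ (z (Fin.last (MZV.weight s + 1))) (Fin.tail (Fin.init z))) / (1 - z 0))) := by
  intro s hs hne f K σ hf hK hσ
  have hk : 0 < s.length := List.length_pos_of_ne_nil hne
  have hN : 0 < MZV.weight s := by
    have h := one_le_sum_take hs hne hk
    rw [List.take_length] at h
    exact h
  exact dilationCalculus_of hN hk (fun m x => ∏ j : Fin (MZV.weight s), if (j : ℕ) < m then x j else 1)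
    (fun _ _ => rfl) σ hσ (fun l => (s.take l).sum) (by simp) (fun l hl => one_le_sum_take hs hne hl)
    f K hf hK

end Summit.KontsevichZagierPeriods.FurushoPentagon.HoffmanRelationInKZ
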